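import Summits.Ventures.PercRepro.ProfileGapMonoThresholdBiColoopDemand

/-!
# PercRepro — THE BI-COLOOP IDENTITY: THE EXACT DEVIATION OF ANY NON-LOOP POINT FROM THE GENERIC DELETION STEP
(p5, gen 25; `proofs/P5-GM1.md` §25(i); announced INBOX before sending)

With the lost sets `U := {bi-coloop S : ρ(S) = q, ρ(E' ∖ S) = t−1}` and `V := {bi-coloop S' : ρ(S') = q−1,
ρ(E' ∖ S') = t−1}`:
* SUPPLY (`card_levelSetCoQ_biColoop`): `#T_t(N) + #V = #T_t(N ∖ z) + #T'_{t−1}(N ／ z) + #U` — `T_t(N)` is the disjoint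
  union of `T_t(N ∖ z)`, of `U`, and of the image of `T' ∖ V` under `S' ↦ S'` (lost) / `S' ∪ z`;
* with the demand side (`thresholdSum_biColoop`, `ProfileGapMonoThresholdBiColoopDemand`), **`biColoop_identity`**:
  `thresholdSum (N∖z) + q·#T(N) + (thresholdSum' + #L') + Σ_{W₁} + q·#V = thresholdSum N + q·#T(N∖z) + q·#T' + q·#U +
  Σ_{W₂}`, i.e. `Δ_z = G + q·#U − q·#V − Σ_{W₁} + Σ_{W₂}` with `G = q·#T' − thresholdSum' − #L'` the generic slack; and
  **`delMonoT_of_biColoop_bound`**: `DelMonoT N z q t` whenever `thresholdSum' + #L' + Σ_{W₁} + q·#V ≤ q·#T' + q·#U +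
  Σ_{W₂}`.
The whole deviation from the generic step is carried by the bi-coloop sets; at a weakly `(q−1)`-generic point there
are none of rank `≤ q − 1` and the bound is the contraction input.  Census: the identity holds to the unit on every
matroid on `≤ 8` elements, every non-loop point, every `q ≥ 2`, `t ≥ q − 1` (work/gm/bicoloop.py, 112,386 instances).

* `biV_subset_levelSetCoQ_contract`, **`card_levelSetCoQ_biColoop`**, **`biColoop_identity`**,
  **`delMonoT_of_biColoop_bound`**.
-/

open scoped Matroid

namespace PercRepro.Cogirth

open Finset ThmH Skew Shadow Profile

variable {α : Type} [DecidableEq α] {M : Matroid α} [M.Finite]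

section BiColoop

variable {N : Matroid α} [N.Finite] {z : α} {q t : ℕ}

/-- `V ⊆ T'`: a bi-coloop rank-`(q−1)` set with `m' = t − 1` is a co-rank-`(t−1)` rank-`(q−1)` set of `N ／ z`. -/
theorem biV_subset_levelSetCoQ_contract (hzI : N.Indep {z}) :
    (Rq N (q - 1)).filter (fun S => z ∉ S ∧ (z ∉ clF N S ∧ z ∉ clF N ((gr N).erase z \ S)) ∧
        rk N ((gr N).erase z \ S) = t - 1) ⊆
      levelSetCoQ (N ／ ({z} : Set α)) (t - 1) (q - 1) := by
  have hz : z ∈ gr N := mem_gr_of_indep hzI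
  intro S hS
  rw [mem_filter, mem_Rq] at hS
  obtain ⟨⟨hSg, hSr⟩, hzS, ⟨hcl1, hcl2⟩, hm⟩ := hS
  have hrk : rk N S = q - 1 := rk_eq_of_eRk_eq_cq hSr
  have hSE : S ⊆ (gr N).erase z := subset_erase.2 ⟨hSg, hzS⟩
  have hY : (gr N).erase z \ S ⊆ (gr N).erase z := sdiff_subset
  have h1 := rk_contract_add_one hzI hSE
  rw [rk_insert_eq hz hSg, if_neg hcl1, hrk] at h1
  have h2 := rk_contract_add_one hzI hY
  rw [rk_insert_eq hz (hY.trans (erase_subset _ _)), if_neg hcl2, hm] at h2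
  rw [mem_levelSetCoQ, gr_contract']
  exact ⟨⟨hSE, eRk_eq_of_rk_eq_cq (by omega)⟩, by omega⟩

/-- **The supply identity at any non-loop point** (`1 ≤ q`, `1 ≤ t`): `#T_t(N) + #V = #T_t(N ∖ z) + #T'_{t−1}(N ／ z)
+ #U`. -/
theorem card_levelSetCoQ_biColoop (hzI : N.Indep {z}) (hq : 1 ≤ q) (ht : 1 ≤ t) :
    (levelSetCoQ N t q).card +
        ((Rq N (q - 1)).filter (fun S => z ∉ S ∧ (z ∉ clF N S ∧ z ∉ clF N ((gr N).erase z \ S)) ∧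
          rk N ((gr N).erase z \ S) = t - 1)).card =
      (levelSetCoQ (N ＼ ({z} : Set α)) t q).card + (levelSetCoQ (N ／ ({z} : Set α)) (t - 1) (q - 1)).card +
        ((Rq N q).filter (fun S => z ∉ S ∧ (z ∉ clF N S ∧ z ∉ clF N ((gr N).erase z \ S)) ∧
          rk N ((gr N).erase z \ S) = t - 1)).card := by
  have hz : z ∈ gr N := mem_gr_of_indep hzI
  set T' := levelSetCoQ (N ／ ({z} : Set α)) (t - 1) (q - 1) with hT'
  set V := (Rq N (q - 1)).filter (fun S => z ∉ S ∧ (z ∉ clF N S ∧ z ∉ clF N ((gr N).erase z \ S)) ∧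
    rk N ((gr N).erase z \ S) = t - 1) with hV
  set U := (Rq N q).filter (fun S => z ∉ S ∧ (z ∉ clF N S ∧ z ∉ clF N ((gr N).erase z \ S)) ∧
    rk N ((gr N).erase z \ S) = t - 1) with hU
  have hVT : V ⊆ T' := biV_subset_levelSetCoQ_contract hzI
  let lost : Finset α → Prop := fun S' => rk N S' = q ∧ rk N ((gr N).erase z \ S') < t
  let f : Finset α → Finset α := fun S' => if lost S' then S' else insert z S'
  have hmem : ∀ S' ∈ T', S' ⊆ (gr N).erase z ∧ rk (N ／ ({z} : Set α)) S' = q - 1 ∧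
      t ≤ rk N (insert z ((gr N).erase z \ S')) := by
    intro S' hS'
    rw [hT', mem_levelSetCoQ, gr_contract'] at hS'
    obtain ⟨⟨hS'g, hS'r⟩, hS'c⟩ := hS'
    have hr' : rk (N ／ ({z} : Set α)) S' = q - 1 := rk_eq_of_eRk_eq_cq hS'r
    have hY : (gr N).erase z \ S' ⊆ (gr N).erase z := sdiff_subset
    have h2 := rk_contract_add_one hzI hY
    exact ⟨hS'g, hr', by omega⟩
  have hrk : ∀ S' ∈ T', rk N S' ≤ q ∧ rk N (insert z S') = q := by
    intro S' hS'
    obtain ⟨hS'g, hr', _⟩ := hmem S' hS'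
    have h := rk_contract_add_one hzI hS'g
    rw [hr'] at h
    have h2 := rk_mono' (M := N) (subset_insert z S')
    exact ⟨by omega, by omega⟩
  -- the image of `T' ∖ V` lies in `T_t(N)`
  have himage : (T' \ V).image f ⊆ levelSetCoQ N t q := by
    intro S hS
    rw [mem_image] at hS
    obtain ⟨S', hS'V, rfl⟩ := hS
    rw [mem_sdiff] at hS'V
    obtain ⟨hS', hnV⟩ := hS'V
    obtain ⟨hS'g, hr', hc⟩ := hmem S' hS'
    obtain ⟨hle, hins⟩ := hrk S' hS'
    have hzS' : z ∉ S' := fun h => (mem_erase.1 (hS'g h)).1 rfl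
    have hY : (gr N).erase z \ S' ⊆ (gr N).erase z := sdiff_subset
    show (if lost S' then S' else insert z S') ∈ levelSetCoQ N t q
    by_cases hl : lost S'
    · rw [if_pos hl]
      obtain ⟨hrq, _⟩ := hl
      rw [mem_levelSetCoQ]
      refine ⟨⟨hS'g.trans (erase_subset _ _), eRk_eq_of_rk_eq_cq hrq⟩, ?_⟩
      rw [gr_sdiff_eq_insert_erase_sdiff hz hzS']
      exact hc
    · rw [if_neg hl]
      have hgood : t ≤ rk N ((gr N).erase z \ S') := by
        by_cases hrq : rk N S' = q
        · by_contra hlt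
          exact hl ⟨hrq, by omega⟩
        · -- `ρ_N(S') = q − 1`, so `z ∉ cl(S')`; `S' ∉ V` then forces `z ∈ cl(E' ∖ S')` or `ρ(E' ∖ S') ≥ t`
          have h4 := rk_insert_le (M := N) z S'
          have hrk' : rk N S' = q - 1 := by omega
          have hcl1 : z ∉ clF N S' := by
            intro h
            have h3 : rk N (insert z S') = rk N S' := by
              rw [rk_insert_eq hz (hS'g.trans (erase_subset _ _)), if_pos h]
            omega
          by_contra hlt
          have hm : rk N ((gr N).erase z \ S') = t - 1 := by
            have h3 := rk_insert_le (M := N) z ((gr N).erase z \ S')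
            omega
          have hcl2 : z ∉ clF N ((gr N).erase z \ S') := by
            intro h
            have h3 : rk N (insert z ((gr N).erase z \ S')) = rk N ((gr N).erase z \ S') := by
              rw [rk_insert_eq hz (hY.trans (erase_subset _ _)), if_pos h]
            omega
          apply hnV
          rw [hV, mem_filter, mem_Rq]
          exact ⟨⟨hS'g.trans (erase_subset _ _), eRk_eq_of_rk_eq_cq hrk'⟩, hzS', ⟨hcl1, hcl2⟩, hm⟩
      exact mem_levelSetCoQ_of_generic_good hzI (q := t) (u := q) hq hS' hgood
  have hinj : Set.InjOn f ((T' \ V : Finset (Finset α)) : Set (Finset α)) := by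
    intro S₁ hS₁ S₂ hS₂ heq
    have hS₁' : S₁ ∈ T' := (mem_sdiff.1 hS₁).1
    have hS₂' : S₂ ∈ T' := (mem_sdiff.1 hS₂).1
    have hz₁ : z ∉ S₁ := fun h => (mem_erase.1 ((hmem S₁ hS₁').1 h)).1 rfl
    have hz₂ : z ∉ S₂ := fun h => (mem_erase.1 ((hmem S₂ hS₂').1 h)).1 rfl
    change (if lost S₁ then S₁ else insert z S₁) = (if lost S₂ then S₂ else insert z S₂) at heq
    by_cases h₁ : lost S₁ <;> by_cases h₂ : lost S₂
    · rw [if_pos h₁, if_pos h₂] at heq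
      exact heq
    · rw [if_pos h₁, if_neg h₂] at heq
      exact absurd (heq ▸ mem_insert_self z S₂) hz₁
    · rw [if_neg h₁, if_pos h₂] at heq
      exact absurd (heq.symm ▸ mem_insert_self z S₁) hz₂
    · rw [if_neg h₁, if_neg h₂] at heq
      rw [← erase_insert hz₁, ← erase_insert hz₂]
      exact congrArg (fun S => S.erase z) heq
  -- `U ⊆ T_t(N)`
  have hUsub : U ⊆ levelSetCoQ N t q := by
    intro S hS
    rw [hU, mem_filter, mem_Rq] at hS
    obtain ⟨⟨hSg, hSr⟩, hzS, ⟨_, hcl2⟩, hm⟩ := hS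
    have hY : (gr N).erase z \ S ⊆ (gr N).erase z := sdiff_subset
    rw [mem_levelSetCoQ]
    refine ⟨⟨hSg, hSr⟩, ?_⟩
    rw [gr_sdiff_eq_insert_erase_sdiff hz hzS, rk_insert_eq hz (hY.trans (erase_subset _ _)), if_neg hcl2, hm]
    omega
  -- the three parts are pairwise disjoint
  have hd1 : Disjoint (levelSetCoQ (N ＼ ({z} : Set α)) t q) U := by
    rw [disjoint_left]
    intro S hS hSU
    rw [mem_levelSetCoQ, gr_delete'] at hS
    obtain ⟨_, hSc⟩ := hS
    rw [hU, mem_filter] at hSU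
    obtain ⟨_, _, _, hm⟩ := hSU
    have hY : (gr N).erase z \ S ⊆ (gr N).erase z := sdiff_subset
    rw [rk_delete hY] at hSc
    omega
  have hd2 : Disjoint (levelSetCoQ (N ＼ ({z} : Set α)) t q) ((T' \ V).image f) := by
    rw [disjoint_left]
    intro S hS hS'
    rw [mem_levelSetCoQ, gr_delete'] at hS
    obtain ⟨⟨hSg, _⟩, hSc⟩ := hS
    rw [mem_image] at hS'
    obtain ⟨S', hS'T, hfS⟩ := hS'
    change (if lost S' then S' else insert z S') = S at hfS
    by_cases hl : lost S'
    · rw [if_pos hl] at hfS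
      subst hfS
      obtain ⟨_, hlt⟩ := hl
      have hY : (gr N).erase z \ S' ⊆ (gr N).erase z := sdiff_subset
      rw [rk_delete hY] at hSc
      omega
    · rw [if_neg hl] at hfS
      subst hfS
      exact (mem_erase.1 (hSg (mem_insert_self z S'))).1 rfl
  have hd3 : Disjoint U ((T' \ V).image f) := by
    rw [disjoint_left]
    intro S hSU hS'
    rw [hU, mem_filter] at hSU
    obtain ⟨_, hzS, ⟨hcl1, _⟩, _⟩ := hSU
    rw [mem_image] at hS'
    obtain ⟨S', hS'T, hfS⟩ := hS'
    have hS'T' : S' ∈ T' := (mem_sdiff.1 hS'T).1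
    change (if lost S' then S' else insert z S') = S at hfS
    by_cases hl : lost S'
    · -- a lost `S'` has `z ∈ cl(S')` (`ρ_N(S') = q = ρ_N(S' ∪ z)`), a member of `U` has not
      rw [if_pos hl] at hfS
      subst hfS
      obtain ⟨hrq, _⟩ := hl
      obtain ⟨_, hins⟩ := hrk S' hS'T'
      have hS'g := (hmem S' hS'T').1
      rw [rk_insert_eq hz (hS'g.trans (erase_subset _ _))] at hins
      by_cases hc : z ∈ clF N S'
      · exact hcl1 hc
      · rw [if_neg hc] at hins
        omega
    · rw [if_neg hl] at hfS
      subst hfS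
      exact hzS (mem_insert_self z S')
  -- `T_t(N)` is covered by the three parts
  have hcover : levelSetCoQ N t q ⊆ (levelSetCoQ (N ＼ ({z} : Set α)) t q ∪ U) ∪ (T' \ V).image f := by
    intro S hS
    have hS0 := hS
    rw [mem_levelSetCoQ] at hS
    obtain ⟨⟨hSg, hSr⟩, hSc⟩ := hS
    have hrkS : rk N S = q := rk_eq_of_eRk_eq_cq hSr
    rw [mem_union, mem_union]
    by_cases hzS : z ∈ S
    · -- through `z`: `S = f (S.erase z)`
      right
      rw [mem_image]
      refine ⟨S.erase z, ?_, ?_⟩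
      · have hS'E : S.erase z ⊆ (gr N).erase z := erase_subset_erase z hSg
        have hins : insert z (S.erase z) = S := insert_erase hzS
        have h1 := rk_contract_add_one hzI hS'E
        rw [hins, hrkS] at h1
        have hcomp : (gr N).erase z \ S.erase z = gr N \ S := by
          ext x
          simp only [mem_sdiff, mem_erase, not_and]
          constructor
          · rintro ⟨⟨hxz, hx⟩, h⟩
            exact ⟨hx, h hxz⟩
          · rintro ⟨hx, hxS⟩
            exact ⟨⟨fun hxz => hxS (hxz ▸ hzS), hx⟩, fun _ => hxS⟩
        have hY : (gr N).erase z \ S.erase z ⊆ (gr N).erase z := sdiff_subset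
        have h2 := rk_contract_add_one hzI hY
        have h3 : rk N (gr N \ S) ≤ rk N (insert z ((gr N).erase z \ S.erase z)) := by
          rw [hcomp]
          exact rk_mono' (subset_insert _ _)
        rw [mem_sdiff]
        constructor
        · rw [hT', mem_levelSetCoQ, gr_contract']
          exact ⟨⟨hS'E, eRk_eq_of_rk_eq_cq (by omega)⟩, by omega⟩
        · -- not in `V`: the complement has rank `≥ t`, not `t − 1`
          intro hV'
          rw [hV, mem_filter] at hV'
          obtain ⟨_, _, _, hm⟩ := hV'
          rw [hcomp] at hm
          omega
      · -- not lost: the complement has rank `≥ t`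
        have hcomp : (gr N).erase z \ S.erase z = gr N \ S := by
          ext x
          simp only [mem_sdiff, mem_erase, not_and]
          constructor
          · rintro ⟨⟨hxz, hx⟩, h⟩
            exact ⟨hx, h hxz⟩
          · rintro ⟨hx, hxS⟩
            exact ⟨⟨fun hxz => hxS (hxz ▸ hzS), hx⟩, fun _ => hxS⟩
        have hnl : ¬ lost (S.erase z) := by
          rintro ⟨_, hlt⟩
          rw [hcomp] at hlt
          omega
        show (if lost (S.erase z) then S.erase z else insert z (S.erase z)) = S
        rw [if_neg hnl, insert_erase hzS]
    · -- `z`-free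
      have hSE : S ⊆ (gr N).erase z := subset_erase.2 ⟨hSg, hzS⟩
      have hY : (gr N).erase z \ S ⊆ (gr N).erase z := sdiff_subset
      have hcomp := gr_sdiff_eq_insert_erase_sdiff hz hzS
      rw [hcomp, rk_insert_eq hz (hY.trans (erase_subset _ _))] at hSc
      by_cases hge : t ≤ rk N ((gr N).erase z \ S)
      · left; left
        rw [mem_levelSetCoQ, gr_delete', rk_delete hY]
        exact ⟨⟨hSE, by rw [← coe_rk, rk_delete hSE, coe_rk]; exact hSr⟩, hge⟩
      · -- the complement has rank `t − 1` and `z` is a coloop of it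
        have hcl2 : z ∉ clF N ((gr N).erase z \ S) := by
          intro h
          rw [if_pos h] at hSc
          omega
        rw [if_neg hcl2] at hSc
        have hm : rk N ((gr N).erase z \ S) = t - 1 := by omega
        by_cases hcl1 : z ∈ clF N S
        · -- lost: `S = f S` with `S ∈ T' ∖ V`
          right
          rw [mem_image]
          refine ⟨S, ?_, ?_⟩
          · rw [mem_sdiff]
            constructor
            · have h1 := rk_contract_add_one hzI hSE
              rw [rk_insert_eq hz hSg, if_pos hcl1, hrkS] at h1
              have h2 := rk_contract_add_one hzI hY
              rw [rk_insert_eq hz (hY.trans (erase_subset _ _)), if_neg hcl2, hm] at h2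
              rw [hT', mem_levelSetCoQ, gr_contract']
              exact ⟨⟨hSE, eRk_eq_of_rk_eq_cq (by omega)⟩, by omega⟩
            · intro hV'
              rw [hV, mem_filter] at hV'
              obtain ⟨_, _, ⟨hc, _⟩, _⟩ := hV'
              exact hc hcl1
          · have hl : lost S := ⟨hrkS, by omega⟩
            show (if lost S then S else insert z S) = S
            rw [if_pos hl]
        · -- bi-coloop: `S ∈ U`
          left; right
          rw [hU, mem_filter, mem_Rq]
          exact ⟨⟨hSg, hSr⟩, hzS, ⟨hcl1, hcl2⟩, hm⟩
  -- assemble the cardinalities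
  have hdisj12 : Disjoint (levelSetCoQ (N ＼ ({z} : Set α)) t q ∪ U) ((T' \ V).image f) :=
    disjoint_union_left.2 ⟨hd2, hd3⟩
  have hsub : (levelSetCoQ (N ＼ ({z} : Set α)) t q ∪ U) ∪ (T' \ V).image f ⊆ levelSetCoQ N t q :=
    union_subset (union_subset (levelSetCoQ_delete_subset_gen z t q) hUsub) himage
  have heq : levelSetCoQ N t q = (levelSetCoQ (N ＼ ({z} : Set α)) t q ∪ U) ∪ (T' \ V).image f :=
    Subset.antisymm hcover hsub
  have hcardV : (T' \ V).card + V.card = T'.card := by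
    rw [card_sdiff_of_subset hVT]
    exact Nat.sub_add_cancel (card_le_card hVT)
  rw [heq, card_union_of_disjoint hdisj12, card_union_of_disjoint hd1, card_image_of_injOn hinj]
  omega

/-- **THE BI-COLOOP IDENTITY** (`2 ≤ q`, `1 ≤ t`): for any non-loop `z`,
`thresholdSum (N∖z) + q·#T(N) + (thresholdSum' + #L') + Σ_{W₁} + q·#V = thresholdSum N + q·#T(N∖z) + q·#T' + q·#U + Σ_{W₂}`,
i.e. `Δ_z = G + q·#U − q·#V − Σ_{W₁} + Σ_{W₂}` with `G = q·#T' − thresholdSum' − #L'` the generic slack. -/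
theorem biColoop_identity (hzI : N.Indep {z}) (hq : 2 ≤ q) (ht : 1 ≤ t) :
    thresholdSum (N ＼ ({z} : Set α)) q t + q * (levelSetCoQ N t q).card +
        (thresholdSum (N ／ ({z} : Set α)) (q - 1) (t - 1) +
          ((Rq (N ／ ({z} : Set α)) (q - 2)).filter
            (fun B' => t ≤ rk (N ／ ({z} : Set α)) (gr (N ／ ({z} : Set α)) \ B'))).card) +
        ∑ B ∈ (Rq N (q - 1)).filter (fun B => z ∉ B ∧ z ∉ clF N B), lostCorr N z t B +
        q * ((Rq N (q - 1)).filter (fun S => z ∉ S ∧ (z ∉ clF N S ∧ z ∉ clF N ((gr N).erase z \ S)) ∧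
          rk N ((gr N).erase z \ S) = t - 1)).card =
      thresholdSum N q t + q * (levelSetCoQ (N ＼ ({z} : Set α)) t q).card +
        q * (levelSetCoQ (N ／ ({z} : Set α)) (t - 1) (q - 1)).card +
        q * ((Rq N q).filter (fun S => z ∉ S ∧ (z ∉ clF N S ∧ z ∉ clF N ((gr N).erase z \ S)) ∧
          rk N ((gr N).erase z \ S) = t - 1)).card +
        ∑ B' ∈ (Rq N (q - 2)).filter (fun B' => z ∉ B' ∧ z ∉ clF N B'), lostCorr N z t B' := by
  have hD := thresholdSum_biColoop hzI hq ht
  have hS := card_levelSetCoQ_biColoop (q := q) (t := t) hzI (by omega) ht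
  have hS' := congrArg (fun n => q * n) hS
  simp only [Nat.mul_add] at hS'
  omega

/-- **Deletion monotonicity from the bi-coloop bound** (`2 ≤ q`, `1 ≤ t`): `DelMonoT N z q t` whenever the
contraction demand with its `#L'`, the rank-`(q−1)` bi-coloop corrections and `q · #V` are at most `q · #T'`, `q · #U`
and the rank-`(q−2)` bi-coloop corrections. -/
theorem delMonoT_of_biColoop_bound (hzI : N.Indep {z}) (hq : 2 ≤ q) (ht : 1 ≤ t)
    (hbound : thresholdSum (N ／ ({z} : Set α)) (q - 1) (t - 1) +
        ((Rq (N ／ ({z} : Set α)) (q - 2)).filter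
          (fun B' => t ≤ rk (N ／ ({z} : Set α)) (gr (N ／ ({z} : Set α)) \ B'))).card +
        ∑ B ∈ (Rq N (q - 1)).filter (fun B => z ∉ B ∧ z ∉ clF N B), lostCorr N z t B +
        q * ((Rq N (q - 1)).filter (fun S => z ∉ S ∧ (z ∉ clF N S ∧ z ∉ clF N ((gr N).erase z \ S)) ∧
          rk N ((gr N).erase z \ S) = t - 1)).card ≤
      q * (levelSetCoQ (N ／ ({z} : Set α)) (t - 1) (q - 1)).card +
        q * ((Rq N q).filter (fun S => z ∉ S ∧ (z ∉ clF N S ∧ z ∉ clF N ((gr N).erase z \ S)) ∧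
          rk N ((gr N).erase z \ S) = t - 1)).card +
        ∑ B' ∈ (Rq N (q - 2)).filter (fun B' => z ∉ B' ∧ z ∉ clF N B'), lostCorr N z t B') :
    DelMonoT N z q t := by
  have h := biColoop_identity hzI hq ht
  unfold DelMonoT
  omega

end BiColoop

end PercRepro.Cogirth
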